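import Summits.ResolutionOfSingularities.KangarooAtlas.MizutaniRationalPoints
import HarnessLib

/-!
# Field automorphisms of `k` on HIRONAKA's side: `U(𝔭)`, `U_+(𝔭)S`, «vector group», «point» are `Aut(k)`-equivariant

Cell `pub-rosobs`, Mizutani enclosure (seat mizutani-encloser-2, gen 9). AI-written; *AI review is weaker than expert
review*; NOT a resolution-of-singularities theorem (summit relevance C).

Mizutani (Nagoya Math. J. 52 (1973) p. 87) calls two pairs `(V, W)`, `(V', W')` «of the same TYPE when there exist a FIELD
AUTOMORPHISM `σ` of `k` and a `k^q`-semi-linear isomorphism `ψ : W → W'` such that `σ ⊗ ψ` sends `V` onto `V'`».  The projective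
(`ψ`) part of this group acts equivariantly on every object of the dictionary (`MizutaniCoordChange`, `MizutaniCoordChangeHironaka`);
this file and its sequel `MizutaniFieldAut.lean` do the same for the `σ` part.  A field automorphism `σ : k ≃+* k` acts on
`S = k[X_0, …, X_n]` through the coefficients, `τ_σ = MvPolynomial.map σ` (a ring automorphism, NOT `k`-linear), and on a point
`𝔭` by `𝔭 ↦ τ_σ^{-1}(𝔭) = 𝔭.comap τ_σ`.  Here, on Hironaka's objects (no characteristic hypothesis):

* `map_symm_map`, `map_map_symm`, `comap_map_ringEquiv_eq_map`, `comap_map_ringEquiv_pow`, `homogeneousComponent_map_ringHom`;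
* **`mem_symbPow_comap_map_iff`** (`mult_{τ^{-1}𝔭}(f) ≥ d ↔ mult_𝔭(τ f) ≥ d`), `isHomogeneous_map_ringEquiv_iff`, `mem_multGens_comap_map_iff`,
  **`mem_multAlgebra_comap_map_iff`** (`U(τ^{-1}𝔭) = τ^{-1}U(𝔭)`);
* **`bIdeal_comap_map`** (`U_+(τ^{-1}𝔭)S = τ^{-1}(U_+(𝔭)S)`), `ringKrullDim_quotient_bIdeal_comap_map`,
  **`isVectorGroup_comap_map_iff`**, **`isPoint_comap_map_iff`**.

## References

* H. Mizutani, *Hironaka's additive group schemes*, Nagoya Math. J. 52 (1973) 85–95, p. 87 («type»), Def. 1.1. [Mizutani1973HironakaGroupSchemes]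
* T. Oda, *Hironaka's additive group scheme, II*, Publ. RIMS 19 (1983), §2 (p. 1168). [Oda1983HironakaGroupSchemeII]
-/

noncomputable section

open MvPolynomial Literature.AlgebraicGeometry.Resolution Literature.AlgebraicGeometry.Resolution.HironakaScheme
  Literature.RingTheory.MvPolynomial

namespace Summit.ResolutionOfSingularities.KangarooAtlas.Mizutani

universe u

section FieldAutHironaka

variable (k : Type u) [Field k] {n : ℕ} (σ : k ≃+* k)

/-- `τ_σ (τ_{σ⁻¹} f) = f`. [folklore] -/
theorem map_map_symm (f : MvPolynomial (Fin (n + 1)) k) :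
    MvPolynomial.map (σ : k →+* k) (MvPolynomial.map (σ.symm : k →+* k) f) = f := by
  rw [MvPolynomial.map_map, RingEquiv.comp_symm, MvPolynomial.map_id]

/-- `τ_{σ⁻¹} (τ_σ f) = f`. [folklore] -/
theorem map_symm_map (f : MvPolynomial (Fin (n + 1)) k) :
    MvPolynomial.map (σ.symm : k →+* k) (MvPolynomial.map (σ : k →+* k) f) = f := by
  rw [MvPolynomial.map_map, RingEquiv.symm_comp, MvPolynomial.map_id]

/-- **`τ_σ^{-1}(J) = τ_{σ⁻¹}(J)`.** [folklore] -/
theorem comap_map_ringEquiv_eq_map (J : Ideal (MvPolynomial (Fin (n + 1)) k)) :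
    J.comap (MvPolynomial.map (σ : k →+* k)) = J.map (MvPolynomial.map (σ.symm : k →+* k)) := by
  refine le_antisymm (fun f hf => ?_) (Ideal.map_le_iff_le_comap.mpr fun g hg => ?_)
  · rw [← map_symm_map k σ f]
    exact Ideal.mem_map_of_mem _ (Ideal.mem_comap.mp hf)
  · rw [Ideal.mem_comap, Ideal.mem_comap, map_map_symm]
    exact hg

/-- `(τ^{-1} J)^d = τ^{-1}(J^d)`. [folklore] -/
theorem comap_map_ringEquiv_pow (J : Ideal (MvPolynomial (Fin (n + 1)) k)) (d : ℕ) :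
    (J.comap (MvPolynomial.map (σ : k →+* k))) ^ d = (J ^ d).comap (MvPolynomial.map (σ : k →+* k)) := by
  rw [comap_map_ringEquiv_eq_map k σ, comap_map_ringEquiv_eq_map k σ, Ideal.map_pow]

/-- Changing coefficients commutes with taking homogeneous components. [folklore] -/
theorem homogeneousComponent_map_ringHom {R S : Type*} [CommRing R] [CommRing S] (f : R →+* S) (d : ℕ)
    (G : MvPolynomial (Fin (n + 1)) R) :
    homogeneousComponent d (MvPolynomial.map f G) = MvPolynomial.map f (homogeneousComponent d G) := by
  classical
  refine MvPolynomial.ext _ _ fun m => ?_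
  rw [coeff_homogeneousComponent, coeff_map, coeff_map, coeff_homogeneousComponent]
  split_ifs <;> simp

/-- **The multiplicity condition is `Aut(k)`-equivariant**: `mult_{τ^{-1}𝔭}(f) ≥ d ↔ mult_𝔭(τ f) ≥ d`.
[cite: Mizutani1973HironakaGroupSchemes, p. 85 L23–25 (U_m(p))] -/
theorem mem_symbPow_comap_map_iff (𝔭 : Ideal (MvPolynomial (Fin (n + 1)) k)) (d : ℕ) (f : MvPolynomial (Fin (n + 1)) k) :
    f ∈ symbPow k (𝔭.comap (MvPolynomial.map (σ : k →+* k))) d ↔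
      MvPolynomial.map (σ : k →+* k) f ∈ symbPow k 𝔭 d := by
  constructor
  · rintro ⟨s, hs, hsf⟩
    refine ⟨MvPolynomial.map (σ : k →+* k) s, fun h => hs (Ideal.mem_comap.mpr h), ?_⟩
    rw [comap_map_ringEquiv_pow k σ, Ideal.mem_comap, map_mul] at hsf
    exact hsf
  · rintro ⟨s, hs, hsf⟩
    refine ⟨MvPolynomial.map (σ.symm : k →+* k) s, fun h => hs ?_, ?_⟩
    · rw [Ideal.mem_comap, map_map_symm] at h
      exact h
    · rw [comap_map_ringEquiv_pow k σ, Ideal.mem_comap, map_mul, map_map_symm]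
      exact hsf

/-- `τ_σ` preserves and reflects forms of degree `d`. [folklore] -/
theorem isHomogeneous_map_ringEquiv_iff {f : MvPolynomial (Fin (n + 1)) k} {d : ℕ} :
    (MvPolynomial.map (σ : k →+* k) f).IsHomogeneous d ↔ f.IsHomogeneous d :=
  ⟨fun h => h.of_map σ.injective, fun h => h.map _⟩

/-- `f ∈ multGens (τ^{-1}𝔭) ↔ τ f ∈ multGens 𝔭`. [cite: Mizutani1973HironakaGroupSchemes, p. 85 L23–25] -/
theorem mem_multGens_comap_map_iff (𝔭 : Ideal (MvPolynomial (Fin (n + 1)) k)) (f : MvPolynomial (Fin (n + 1)) k) :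
    f ∈ multGens k (𝔭.comap (MvPolynomial.map (σ : k →+* k))) ↔
      MvPolynomial.map (σ : k →+* k) f ∈ multGens k 𝔭 := by
  constructor
  · rintro ⟨d, hd, hf⟩
    exact ⟨d, hd.map _, (mem_symbPow_comap_map_iff k σ 𝔭 d f).mp hf⟩
  · rintro ⟨d, hd, hf⟩
    exact ⟨d, (isHomogeneous_map_ringEquiv_iff k σ).mp hd, (mem_symbPow_comap_map_iff k σ 𝔭 d f).mpr hf⟩

/-- `τ_σ` maps the `k`-algebra `U(𝔭')` into `U(𝔭)` when it maps generators to generators (`τ` is semilinear: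
`τ(c • g) = σ(c) • τ g`). [folklore] -/
theorem map_mem_adjoin_of_forall {G G' : Set (MvPolynomial (Fin (n + 1)) k)} (ρ : k ≃+* k)
    (hG : ∀ g ∈ G', MvPolynomial.map (ρ : k →+* k) g ∈ Algebra.adjoin k G) {f : MvPolynomial (Fin (n + 1)) k}
    (hf : f ∈ Algebra.adjoin k G') : MvPolynomial.map (ρ : k →+* k) f ∈ Algebra.adjoin k G := by
  induction hf using Algebra.adjoin_induction with
  | mem x hx => exact hG x hx
  | algebraMap c =>
    rw [MvPolynomial.algebraMap_eq, map_C]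
    exact Subalgebra.algebraMap_mem _ _
  | add x y _ _ hx hy => rw [map_add]; exact Subalgebra.add_mem _ hx hy
  | mul x y _ _ hx hy => rw [map_mul]; exact Subalgebra.mul_mem _ hx hy

/-- **`U(τ^{-1}𝔭) = τ^{-1} U(𝔭)`**: `f ∈ U(τ^{-1}𝔭) ↔ τ f ∈ U(𝔭)`. [cite: Mizutani1973HironakaGroupSchemes, p. 85 L21–25 (U(p))] -/
theorem mem_multAlgebra_comap_map_iff (𝔭 : Ideal (MvPolynomial (Fin (n + 1)) k)) (f : MvPolynomial (Fin (n + 1)) k) :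
    f ∈ multAlgebra k (𝔭.comap (MvPolynomial.map (σ : k →+* k))) ↔
      MvPolynomial.map (σ : k →+* k) f ∈ multAlgebra k 𝔭 := by
  unfold multAlgebra
  constructor
  · intro hf
    exact map_mem_adjoin_of_forall k σ
      (fun g hg => Algebra.subset_adjoin ((mem_multGens_comap_map_iff k σ 𝔭 g).mp hg)) hf
  · intro hf
    have h := map_mem_adjoin_of_forall k (G := multGens k (𝔭.comap (MvPolynomial.map (σ : k →+* k)))) σ.symm
      (fun g hg => Algebra.subset_adjoin
        ((mem_multGens_comap_map_iff k σ 𝔭 _).mpr (by rw [map_map_symm]; exact hg))) hf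
    rwa [map_symm_map] at h

/-- **`U_+(τ^{-1}𝔭)S = τ^{-1}(U_+(𝔭)S)`: the Hironaka scheme of the conjugate point is the conjugate scheme.**
[cite: Mizutani1973HironakaGroupSchemes, Def. 1.1] -/
theorem bIdeal_comap_map (𝔭 : Ideal (MvPolynomial (Fin (n + 1)) k)) :
    bIdeal k (𝔭.comap (MvPolynomial.map (σ : k →+* k))) = (bIdeal k 𝔭).comap (MvPolynomial.map (σ : k →+* k)) := by
  unfold bIdeal
  conv_rhs => rw [comap_map_ringEquiv_eq_map k σ, Ideal.map_span]
  congr 1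
  ext f
  constructor
  · rintro ⟨hU, hc⟩
    refine ⟨MvPolynomial.map (σ : k →+* k) f, ⟨(mem_multAlgebra_comap_map_iff k σ 𝔭 f).mp hU, ?_⟩, map_symm_map k σ f⟩
    show constantCoeff (MvPolynomial.map (σ : k →+* k) f) = 0
    have hc : constantCoeff f = 0 := hc
    rw [constantCoeff_map, hc, map_zero]
  · rintro ⟨g, ⟨hU, hc⟩, rfl⟩
    refine ⟨(mem_multAlgebra_comap_map_iff k σ 𝔭 _).mpr ?_, ?_⟩
    · rw [map_map_symm]
      exact hU
    · show constantCoeff (MvPolynomial.map (σ.symm : k →+* k) g) = 0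
      have hc : constantCoeff g = 0 := hc
      rw [constantCoeff_map, hc, map_zero]

/-- **`dim B_{P,𝔭}` is `Aut(k)`-invariant on Hironaka's side**: `ringKrullDim (S ⧸ U_+(τ^{-1}𝔭)S) = ringKrullDim (S ⧸ U_+(𝔭)S)`.
[cite: Mizutani1973HironakaGroupSchemes, Def. 1.1 and Thm. 1.3] -/
theorem ringKrullDim_quotient_bIdeal_comap_map (𝔭 : Ideal (MvPolynomial (Fin (n + 1)) k)) :
    ringKrullDim (MvPolynomial (Fin (n + 1)) k ⧸ bIdeal k (𝔭.comap (MvPolynomial.map (σ : k →+* k)))) =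
      ringKrullDim (MvPolynomial (Fin (n + 1)) k ⧸ bIdeal k 𝔭) := by
  have hmap : bIdeal k (𝔭.comap (MvPolynomial.map (σ : k →+* k))) =
      (bIdeal k 𝔭).map ((mapEquiv (Fin (n + 1)) σ.symm :
        MvPolynomial (Fin (n + 1)) k ≃+* MvPolynomial (Fin (n + 1)) k) :
          MvPolynomial (Fin (n + 1)) k →+* MvPolynomial (Fin (n + 1)) k) := by
    rw [bIdeal_comap_map k σ, comap_map_ringEquiv_eq_map k σ]
    rfl
  exact (ringKrullDim_eq_of_ringEquiv (Ideal.quotientEquiv _ _ (mapEquiv (Fin (n + 1)) σ.symm) hmap)).symm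

/-- **«`B_{P,𝔭}` is a vector group» is `Aut(k)`-invariant.** [cite: Mizutani1973HironakaGroupSchemes, p. 85 L15 and Rem. 1.2] -/
theorem isVectorGroup_comap_map_iff (𝔭 : Ideal (MvPolynomial (Fin (n + 1)) k)) :
    IsVectorGroup k (𝔭.comap (MvPolynomial.map (σ : k →+* k))) ↔ IsVectorGroup k 𝔭 := by
  have key : ∀ (ρ : k ≃+* k) (I : Ideal (MvPolynomial (Fin (n + 1)) k)),
      I = Ideal.span ((I : Set (MvPolynomial (Fin (n + 1)) k)) ∩
        (homogeneousSubmodule (Fin (n + 1)) k 1 : Set (MvPolynomial (Fin (n + 1)) k))) →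
      I.comap (MvPolynomial.map (ρ : k →+* k)) =
        Ideal.span ((I.comap (MvPolynomial.map (ρ : k →+* k)) : Set (MvPolynomial (Fin (n + 1)) k)) ∩
          (homogeneousSubmodule (Fin (n + 1)) k 1 : Set (MvPolynomial (Fin (n + 1)) k))) := by
    intro ρ I hI
    refine le_antisymm ?_ (Ideal.span_le.mpr fun f hf => hf.1)
    conv_lhs => rw [hI, comap_map_ringEquiv_eq_map k ρ, Ideal.map_span]
    refine Ideal.span_mono ?_
    rintro _ ⟨g, ⟨hgI, hg1⟩, rfl⟩
    refine ⟨?_, ?_⟩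
    · rw [SetLike.mem_coe, Ideal.mem_comap, map_map_symm]
      exact hgI
    · exact (mem_homogeneousSubmodule 1 _).mpr (((mem_homogeneousSubmodule 1 _).mp hg1).map _)
  unfold IsVectorGroup
  rw [bIdeal_comap_map k σ]
  constructor
  · intro h
    have h2 := key σ.symm _ h
    have hcc : ((bIdeal k 𝔭).comap (MvPolynomial.map (σ : k →+* k))).comap (MvPolynomial.map (σ.symm : k →+* k)) =
        bIdeal k 𝔭 := by
      ext f
      rw [Ideal.mem_comap, Ideal.mem_comap, map_map_symm]
    rwa [hcc] at h2
  · exact key σ _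

/-- **«Point of `ℙ^n_k`» is `Aut(k)`-invariant.** [cite: Oda1983HironakaGroupSchemeII, §2 (p. 1168)] -/
theorem isPoint_comap_map {𝔭 : Ideal (MvPolynomial (Fin (n + 1)) k)} (hP : IsPoint k 𝔭) :
    IsPoint k (𝔭.comap (MvPolynomial.map (σ : k →+* k))) := by
  haveI := hP.1
  refine ⟨Ideal.comap_isPrime _ _, fun f hf d => ?_, fun hle => hP.2.2 fun g hg => ?_⟩
  · rw [Ideal.mem_comap, ← homogeneousComponent_map_ringHom]
    exact hP.2.1 _ (Ideal.mem_comap.mp hf) d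
  · have hg' : MvPolynomial.map (σ.symm : k →+* k) g ∈ irrelevant k n := by
      unfold irrelevant at hg ⊢
      rw [RingHom.mem_ker] at hg ⊢
      rw [constantCoeff_map, hg, map_zero]
    have h := Ideal.mem_comap.mp (hle hg')
    rwa [map_map_symm] at h

/-- … as an `iff`. [cite: Oda1983HironakaGroupSchemeII, §2 (p. 1168)] -/
theorem isPoint_comap_map_iff (𝔭 : Ideal (MvPolynomial (Fin (n + 1)) k)) :
    IsPoint k (𝔭.comap (MvPolynomial.map (σ : k →+* k))) ↔ IsPoint k 𝔭 := by
  refine ⟨fun h => ?_, isPoint_comap_map k σ⟩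
  have h2 := isPoint_comap_map k σ.symm h
  have hcc : (𝔭.comap (MvPolynomial.map (σ : k →+* k))).comap (MvPolynomial.map (σ.symm : k →+* k)) = 𝔭 := by
    ext f
    rw [Ideal.mem_comap, Ideal.mem_comap, map_map_symm]
  rwa [hcc] at h2

end FieldAutHironaka

end Summit.ResolutionOfSingularities.KangarooAtlas.Mizutani

end
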